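import Literature.Barriers.QuantumAdvantage.TensorNetworkContractionSegmentsTreewidth
import HarnessLib

/-!
# Barrier catalogue `QuantumAdvantage` — Lemma 4.4 for ROOTED decompositions: the rooted decomposition of the segment network

Companion to `TensorNetworkContractionTreewidth.lean` (`RootedTreeDecomposition G k`, the normal
form in which Step 2 of Markov–Shi's Thm 4.6 hands a tree decomposition of the circuit graph
`G_C` to the machine of Steps 3–4: parent array with `parent i < i`, rooted (T3) `mem_bag_parent`)
and to `TensorNetworkContractionSegmentsTreewidth.lean` (`segDecomposition`: Markov–Shi's Lemma 4.4
"replace each vertex `v` with all edges incident to `v`" for UNROOTED decompositions, via Mathlib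
connectivity). The contraction of Steps 3–4 runs on the indices of the network (the wire segments),
so the supplied rooted decomposition of `G_C` must be turned into a rooted decomposition of the
primal graph of the segment network `N(C; z₀, obs)` **in the same rooted normal form** — same
parent array, bag `i` ↦ the segments carried by the nodes of bag `i` — and the point is that rooted
(T3) survives, by an argument on bag indices only (no walks in the tree are needed):

* `RootedTreeDecomposition.up D m t` — the `m`-th ancestor of `t`; `mem_bag_up` (rooted (T3)
  iterated along the ancestor chain); **`mem_bag_parent_or`**: if `a ∈ B_i`, `u ∈ B_j` with `j < i`
  and `a = u` or `a ~ u` in `G`, then `a` or `u` lies in `B_{parent i}` (climb from a bag containing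
  both `a` and `u` towards the root until the index drops to `≤ i`);
* **`RootedTreeDecomposition.primal D Nw`** — for a network `Nw` whose tensors are the vertices of
  `G` such that two tensors sharing an index are adjacent (`hshare`) and every index is carried
  (`hcov`): the rooted decomposition of `Nw.primalGraph` with bags `⋃_{f ∈ B_i} scope f`
  (Lemma 4.4, rooted form); `scope_subset_primal_bag`, `card_primal_bag_le(_width)`;
* **`segRooted C A z₀ obs D`** — the instance for the segment network of a circuit
  (`hshare` = `adj_of_mem_scope_of_ne` from `Seg.consecutive_of_mem_scope`: two nodes carrying a
  segment are the ends of that wire segment, an edge of `G_C`; `hcov` = `Seg.mem_scope_startNode`),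
  with `card_segRooted_bag_le(_width)`: bags of `≤ (2q+1)·|B_i| ≤ (2q+1)(w+1)` segments when gates
  act on `≤ q` wires — the width `O(tw(G_C))` of Thm 4.6 for the decomposition actually contracted
  along in the discharge of `markovShi2008_thm46`.

## References

* [MarkovShi2008] I. L. Markov, Y. Shi, *Simulating quantum computation by contracting tensor
  networks*, SIAM J. Comput. 38 (2008) 963–981 (arXiv:quant-ph/0511069), §4: Lemma 4.4 and its
  proof (pp. 9–10), Thm 4.6 (Step 2 output consumed by Steps 3–4, p. 10); §2 ((T1)–(T3), p. 5).
  Read via `lit read paper:arxiv-quant-ph_0511069`.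
-/

noncomputable section

namespace Literature.Barriers.QuantumAdvantage

open Finset Literature.LinearAlgebra.TensorNetworks Literature.Computability.Cryptography

namespace RootedTreeDecomposition

variable {V : Type*} {G : SimpleGraph V} {k : ℕ}

/-! ### Ancestors and iterated (T3) -/

/-- The `m`-th ancestor of the bag index `t` (`up 0 t = t`, `up (m+1) t = parent (up m t)`; past
the root the value is irrelevant). [folklore] -/
def up (D : RootedTreeDecomposition G k) (m : ℕ) (t : Fin k) : Fin k := D.parent^[m] t

/-- `up 0 t = t`. [folklore] -/
@[simp] theorem up_zero (D : RootedTreeDecomposition G k) (t : Fin k) : D.up 0 t = t := rfl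

/-- `up (m+1) t = parent (up m t)`. [folklore] -/
theorem up_succ (D : RootedTreeDecomposition G k) (m : ℕ) (t : Fin k) :
    D.up (m + 1) t = D.parent (D.up m t) :=
  Function.iterate_succ_apply' _ _ _

/-- The ancestor chain of `t` descends to any level `i`: some ancestor has index `≤ i` (the index
decreases strictly while positive, and `0 ≤ i`). [folklore] -/
theorem exists_up_le (D : RootedTreeDecomposition G k) (t : Fin k) (i : ℕ) :
    ∃ m, (D.up m t : ℕ) ≤ i := by
  have key : ∀ m, (∃ m' ≤ m, (D.up m' t : ℕ) ≤ i) ∨ (D.up m t : ℕ) + m ≤ t := by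
    intro m
    induction m with
    | zero => exact Or.inr (by simp)
    | succ m ih =>
      rcases ih with ⟨m', hm', h⟩ | h
      · exact Or.inl ⟨m', hm'.trans (Nat.le_succ m), h⟩
      · by_cases hle : (D.up m t : ℕ) ≤ i
        · exact Or.inl ⟨m, Nat.le_succ m, hle⟩
        · right
          have hlt : (D.up (m + 1) t : ℕ) < D.up m t := by
            rw [D.up_succ]
            exact D.parent_lt _ (by omega)
          omega
  rcases key (t + 1) with ⟨m', -, h⟩ | h
  · exact ⟨m', h⟩
  · omega

/-- **Rooted (T3) iterated along the ancestor chain**: a vertex of `B_t` and of `B_j` lies in every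
ancestor `up m t` as long as the chain has stayed strictly above `j`. [cite: MarkovShi2008, §2 ((T3))] -/
theorem mem_bag_up (D : RootedTreeDecomposition G k) {v : V} {t j : Fin k} (hvt : v ∈ D.bag t)
    (hvj : v ∈ D.bag j) : ∀ m, (∀ m' < m, (j : ℕ) < D.up m' t) → v ∈ D.bag (D.up m t)
  | 0, _ => hvt
  | m + 1, h => by
    rw [D.up_succ]
    exact D.mem_bag_parent v _ (D.mem_bag_up hvt hvj m fun m' hm' => h m' (by omega))
      ⟨j, hvj, h m (Nat.lt_succ_self m)⟩

/-- **The rooted (T3) of a union of bags along an edge.** If `a ∈ B_i` and `u ∈ B_j` with `j < i`,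
and `a = u` or `a ~ u` in `G`, then `a ∈ B_{parent i}` or `u ∈ B_{parent i}`: for `a = u` this is
rooted (T3); otherwise take a bag `B_t ∋ a, u` ((T2)); if `t < i` or `t = i` apply (T3) at `i` to
`a`, resp. `u`; if `t > i` climb the ancestors of `t` down to the first index `≤ i` — both `a` and
`u` are carried along ((T3) iterated) — and conclude in the same two ways. [cite: MarkovShi2008, §2 ((T2), (T3)) and §4 (Lemma 4.4, proof of (T3) for 𝒯*)] -/
theorem mem_bag_parent_or (D : RootedTreeDecomposition G k) {a u : V} {i j : Fin k}
    (hai : a ∈ D.bag i) (huj : u ∈ D.bag j) (hji : (j : ℕ) < i) (hadj : a = u ∨ G.Adj a u) :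
    a ∈ D.bag (D.parent i) ∨ u ∈ D.bag (D.parent i) := by
  classical
  rcases hadj with rfl | hadj
  · exact Or.inl (D.mem_bag_parent a i hai ⟨j, huj, hji⟩)
  obtain ⟨t, hat, hut⟩ := D.exists_mem_bag_of_adj hadj
  rcases lt_trichotomy (t : ℕ) i with hlt | heq | hgt
  · exact Or.inl (D.mem_bag_parent a i hai ⟨t, hat, hlt⟩)
  · have hti : t = i := Fin.ext heq
    subst hti
    exact Or.inr (D.mem_bag_parent u t hut ⟨j, huj, hji⟩)
  · have hex : ∃ m, (D.up m t : ℕ) ≤ i := D.exists_up_le t i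
    have hma : (D.up (Nat.find hex) t : ℕ) ≤ i := Nat.find_spec hex
    have hbefore : ∀ m' < Nat.find hex, (i : ℕ) < D.up m' t := fun m' hm' =>
      lt_of_not_ge (Nat.find_min hex hm')
    have ha : a ∈ D.bag (D.up (Nat.find hex) t) := D.mem_bag_up hat hai _ hbefore
    rcases hma.lt_or_eq with hlt' | heq'
    · exact Or.inl (D.mem_bag_parent a i hai ⟨_, ha, hlt'⟩)
    · have hti : D.up (Nat.find hex) t = i := Fin.ext heq'
      have hu : u ∈ D.bag (D.up (Nat.find hex) t) :=
        D.mem_bag_up hut huj _ fun m' hm' => hji.trans (hbefore m' hm')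
      rw [hti] at hu
      exact Or.inr (D.mem_bag_parent u i hu ⟨j, huj, hji⟩)

/-! ### Lemma 4.4, rooted form -/

section Primal

variable {R : Type*} [CommSemiring R] {Var Dom : Type*} [DecidableEq Var]

/-- **The rooted decomposition of the primal graph of a network from a rooted decomposition of a
graph on its tensors** (Markov–Shi Lemma 4.4, "replacing each vertex `v ∈ V(G)` with all edges `e`
incident to `v`", in the rooted normal form): same parent array, bag `i` ↦ `⋃_{f ∈ B_i} scope f`.
Hypotheses: two tensors sharing an index are adjacent in `G` (for the network drawn on `G`: the two
ends of the edge that the index is), and every index is carried by some tensor. (T2): a factor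
carrying two indices lies in some bag; (T1): from `hcov`; rooted (T3): `mem_bag_parent_or`.
[cite: MarkovShi2008, §4 (Lemma 4.4)] -/
def primal (D : RootedTreeDecomposition G k) (Nw : TensorNetwork R Var Dom V)
    (hshare : ∀ ⦃x : Var⦄ ⦃f g : V⦄, x ∈ Nw.scope f → x ∈ Nw.scope g → f ≠ g → G.Adj f g)
    (hcov : ∀ x : Var, ∃ f, x ∈ Nw.scope f) : RootedTreeDecomposition Nw.primalGraph k where
  pos := D.pos
  parent := D.parent
  parent_lt := D.parent_lt
  bag i := (D.bag i).biUnion Nw.scope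
  exists_mem_bag_of_adj := by
    intro x y hxy
    obtain ⟨-, f, hx, hy⟩ := (Nw.primalGraph_adj x y).1 hxy
    obtain ⟨i, hi⟩ := D.exists_mem_bag f
    exact ⟨i, mem_biUnion.2 ⟨f, hi, hx⟩, mem_biUnion.2 ⟨f, hi, hy⟩⟩
  exists_mem_bag x := by
    obtain ⟨f, hf⟩ := hcov x
    obtain ⟨i, hi⟩ := D.exists_mem_bag f
    exact ⟨i, mem_biUnion.2 ⟨f, hi, hf⟩⟩
  mem_bag_parent x i hx hj := by
    obtain ⟨j, hxj, hji⟩ := hj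
    obtain ⟨a, hai, hxa⟩ := mem_biUnion.1 hx
    obtain ⟨u, huj, hxu⟩ := mem_biUnion.1 hxj
    have hadj : a = u ∨ G.Adj a u := by
      by_cases h : a = u
      · exact Or.inl h
      · exact Or.inr (hshare hxa hxu h)
    rcases D.mem_bag_parent_or hai huj hji hadj with h | h
    · exact mem_biUnion.2 ⟨a, h, hxa⟩
    · exact mem_biUnion.2 ⟨u, h, hxu⟩

variable {D : RootedTreeDecomposition G k} {Nw : TensorNetwork R Var Dom V}
  {hshare : ∀ ⦃x : Var⦄ ⦃f g : V⦄, x ∈ Nw.scope f → x ∈ Nw.scope g → f ≠ g → G.Adj f g}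
  {hcov : ∀ x : Var, ∃ f, x ∈ Nw.scope f}

/-- The bags of the primal decomposition. [cite: MarkovShi2008, §4 (Lemma 4.4)] -/
@[simp] theorem primal_bag (i : Fin k) : (D.primal Nw hshare hcov).bag i = (D.bag i).biUnion Nw.scope := rfl

/-- The primal decomposition has the same parent array. [folklore] -/
@[simp] theorem primal_parent : (D.primal Nw hshare hcov).parent = D.parent := rfl

/-- **Every tensor is homed**: the scope of a tensor of bag `i` lies in the `i`-th primal bag
("(T2) is true since if `e₁` and `e₂` are both incident to a vertex `u` in `G`, then any bag in `𝒯`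
containing `u` contains both `e₁` and `e₂` in `𝒯*`"). [cite: MarkovShi2008, §4 (Lemma 4.4)] -/
theorem scope_subset_primal_bag {f : V} {i : Fin k} (hf : f ∈ D.bag i) :
    Nw.scope f ⊆ (D.primal Nw hshare hcov).bag i :=
  fun _ hx => mem_biUnion.2 ⟨f, hf, hx⟩

/-- **Width of the primal decomposition**: with scopes of size `≤ q`, the `i`-th primal bag has at
most `q · |B_i|` indices. [cite: MarkovShi2008, §4 (Lemma 4.4: width (d+1)·Δ(G) − 1)] -/
theorem card_primal_bag_le {q : ℕ} (hq : ∀ f, (Nw.scope f).card ≤ q) (i : Fin k) :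
    ((D.primal Nw hshare hcov).bag i).card ≤ q * (D.bag i).card := by
  rw [primal_bag]
  refine card_biUnion_le.trans ?_
  calc ∑ f ∈ D.bag i, (Nw.scope f).card ≤ ∑ f ∈ D.bag i, q := sum_le_sum fun f _ => hq f
    _ = q * (D.bag i).card := by rw [sum_const, smul_eq_mul, Nat.mul_comm]

/-- Width of the primal decomposition against the width of `D`: every primal bag has at most
`q · (width D + 1)` indices. [cite: MarkovShi2008, §4 (Lemma 4.4)] -/
theorem card_primal_bag_le_width {q : ℕ} (hq : ∀ f, (Nw.scope f).card ≤ q) (i : Fin k) :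
    ((D.primal Nw hshare hcov).bag i).card ≤ q * (D.width + 1) :=
  (card_primal_bag_le hq i).trans (Nat.mul_le_mul_left q (D.card_bag_le_width_add_one i))

end Primal

end RootedTreeDecomposition

/-! ### The rooted decomposition of the segment network of a circuit -/

section Circuit

variable {Gs : QGateSet} {N : ℕ}

/-- **Two nodes carrying a common segment are adjacent in the circuit graph**: they are the two ends
of the wire segment (`Seg.consecutive_of_mem_scope`, `Consecutive.right_unique`).
[cite: MarkovShi2008, §2 (the graph G_C: "each wire segment can now be represented by an edge")] -/
theorem adj_of_mem_scope_of_ne {C : QCircuit Gs N} (A : Language Bool) (z₀ : QReg N)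
    (obs : Fin N → Bool → ℂ) {s : Seg C} {u v : CircuitNode C.gates.length N}
    (hu : s ∈ (segmentNetwork C A z₀ obs).scope u) (hv : s ∈ (segmentNetwork C A z₀ obs).scope v)
    (huv : u ≠ v) : (circuitGraph C).Adj u v := by
  by_cases hus : u = s.startNode
  · subst hus
    exact circuitGraph_adj.2 ⟨huv, Or.inl ⟨_, Seg.consecutive_of_mem_scope hv (Ne.symm huv)⟩⟩
  · by_cases hvs : v = s.startNode
    · subst hvs
      exact circuitGraph_adj.2 ⟨huv, Or.inr ⟨_, Seg.consecutive_of_mem_scope hu huv⟩⟩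
    · exact absurd ((Seg.consecutive_of_mem_scope hu hus).right_unique
        (Seg.consecutive_of_mem_scope hv hvs)) huv

/-- **The rooted decomposition of the segment network** `N(C; z₀, obs)` induced by a rooted
decomposition of the circuit graph (Lemma 4.4 in the rooted normal form of `markovShi2008_thm46`'s
hypothesis): same parent array, bag `i` ↦ the segments carried by the nodes of `B_i`.
[cite: MarkovShi2008, §4 (Lemma 4.4, Thm 4.6 Steps 2–3)] -/
def segRooted (C : QCircuit Gs N) (A : Language Bool) (z₀ : QReg N) (obs : Fin N → Bool → ℂ) {k : ℕ}
    (D : RootedTreeDecomposition (circuitGraph C) k) :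
    RootedTreeDecomposition (segmentNetwork C A z₀ obs).primalGraph k :=
  D.primal (segmentNetwork C A z₀ obs) (fun _ _ _ hu hv huv => adj_of_mem_scope_of_ne A z₀ obs hu hv huv)
    fun s => ⟨s.startNode, Seg.mem_scope_startNode A z₀ obs s⟩

/-- The bags of `segRooted`. [cite: MarkovShi2008, §4 (Lemma 4.4)] -/
@[simp] theorem segRooted_bag (C : QCircuit Gs N) (A : Language Bool) (z₀ : QReg N)
    (obs : Fin N → Bool → ℂ) {k : ℕ} (D : RootedTreeDecomposition (circuitGraph C) k) (i : Fin k) :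
    (segRooted C A z₀ obs D).bag i = (D.bag i).biUnion (segmentNetwork C A z₀ obs).scope := rfl

/-- `segRooted` keeps the parent array. [folklore] -/
@[simp] theorem segRooted_parent (C : QCircuit Gs N) (A : Language Bool) (z₀ : QReg N)
    (obs : Fin N → Bool → ℂ) {k : ℕ} (D : RootedTreeDecomposition (circuitGraph C) k) :
    (segRooted C A z₀ obs D).parent = D.parent := rfl

/-- Every tensor of the segment network is homed: the scope of a node of `B_i` lies in the `i`-th
segment bag. [cite: MarkovShi2008, §4 (Lemma 4.4)] -/
theorem scope_subset_segRooted_bag (C : QCircuit Gs N) (A : Language Bool) (z₀ : QReg N)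
    (obs : Fin N → Bool → ℂ) {k : ℕ} (D : RootedTreeDecomposition (circuitGraph C) k)
    {u : CircuitNode C.gates.length N} {i : Fin k} (hu : u ∈ D.bag i) :
    (segmentNetwork C A z₀ obs).scope u ⊆ (segRooted C A z₀ obs D).bag i :=
  RootedTreeDecomposition.scope_subset_primal_bag hu

/-- **Width of the segment decomposition**: if every gate acts on `≤ q` wires, the `i`-th segment
bag has at most `(2q+1) · |B_i|` segments (`card_scope_segmentNetwork_le`).
[cite: MarkovShi2008, §4 (Lemma 4.4)] -/
theorem card_segRooted_bag_le (C : QCircuit Gs N) (A : Language Bool) (z₀ : QReg N)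
    (obs : Fin N → Bool → ℂ) {k : ℕ} (D : RootedTreeDecomposition (circuitGraph C) k) {q : ℕ}
    (hq : ∀ g ∈ C.gates, g.wires.card ≤ q) (i : Fin k) :
    ((segRooted C A z₀ obs D).bag i).card ≤ (2 * q + 1) * (D.bag i).card :=
  RootedTreeDecomposition.card_primal_bag_le (card_scope_segmentNetwork_le A z₀ obs hq) i

/-- **The width parameter of the contraction in the discharge of `markovShi2008_thm46`**: with gates
on `≤ q` wires and a supplied rooted decomposition of `G_C` of width `w`, every segment bag has at
most `(2q+1)(w+1)` segments — tables of `4^{(2q+1)(w+1)}` entries, polynomial for `w = O(log n)`.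
[cite: MarkovShi2008, §4 (Lemma 4.4, Thm 4.6)] -/
theorem card_segRooted_bag_le_width (C : QCircuit Gs N) (A : Language Bool) (z₀ : QReg N)
    (obs : Fin N → Bool → ℂ) {k : ℕ} (D : RootedTreeDecomposition (circuitGraph C) k) {q : ℕ}
    (hq : ∀ g ∈ C.gates, g.wires.card ≤ q) (i : Fin k) :
    ((segRooted C A z₀ obs D).bag i).card ≤ (2 * q + 1) * (D.width + 1) :=
  RootedTreeDecomposition.card_primal_bag_le_width (card_scope_segmentNetwork_le A z₀ obs hq) i

end Circuit

end Literature.Barriers.QuantumAdvantage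

end
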